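import Mathlib.RingTheory.DiscreteValuationRing.Basic
import Literature.Algebra.EuclideanDomain.MinimalEuclideanFunctionSuperadditive
import HarnessLib

/-!
# A discrete valuation ring is Euclidean for `1 + v`, which is its smallest algorithm; `θ(x) ≥ 1 + Σ v_p(x)`
# (Samuel 1971, §2 Cor. 2, §3 Prop. 5 Cor., §4 Example (3))

Topic `Literature/Algebra/EuclideanDomain`, namespace `Literature.Algebra.EuclideanDomain` (continuing
`MotzkinConstruction.lean` and `MinimalEuclideanFunctionSuperadditive.lean`: `motzkinSet k = P₀^{(k)}`,
`motzkinRank` = Samuel's smallest algorithm `θ`, `motzkinNorm = θ − 1`).  THEOREMS ONLY (no `def`, no instance,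
no named fact); everything PROVED.

## Source (read at the page)

P. Samuel, *About Euclidean rings*, J. Algebra **19** (1971) 282–301 [Samuel1971] (materialised
`paper:doi-10-1016-0021-8693-71-90110-4`, pp. 284–285, 290), VERBATIM:
* §2, Corollary 2 to Proposition 4 (pp. 284–285): «Assume that the well-ordered set `W` contains `ℕ` as an initial
  segment, and that the Euclidean ring `A` is a domain.  Let `(v_p)_{p ∈ P}` be the set of all normalized valuations
  of `A` (corresponding to the prime elements of `A`).  Then, for any algorithm `φ` on `A`, we have
  `φ(x) ≥ 1 + Σ_{p∈P} v_p(x)` for any `x ≠ 0` in `A`.» (2.1)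
* §3, Proposition 5 (p. 285): «A principal ideal domain with a finite number of maximal ideals `Ap₁, …, Ap_n` is
  Euclidean for the algorithm `φ(x) = 1 + Σᵢ vᵢ(x)` (`x ≠ 0`), `φ(0) = 0`» and its Corollary: «The ring of a
  discrete valuation `v` is Euclidean for `φ(x) = 1 + v(x)` (`x ≠ 0`).»
* §4, Example (3) (p. 290): «Let `A` be a principal ideal domain with a finite number of maximal ideals … the
  smallest algorithm `θ` on `A` is given by `θ(x) = 1 + Σᵢ vᵢ(x)` (`x ≠ 0`).»

## What is formalised (the one-maximal-ideal case `n = 1`, and (2.1) through Motzkin's sets)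

* `IsDiscreteValuationRing.euclidean_addVal` — the Corollary to Prop. 5: in a DVR with valuation `v = addVal R`,
  for `b ≠ 0` every `a` is `bq + s` with `s = 0` or `v(s) < v(b)` (indeed `s = 0` if `b ∣ a`, and `s = a`, `q = 0`
  otherwise); `euclidean_one_add_addVal` is Samuel's literal form with `φ(x) = 1 + v(x)`, `φ(0) = 0`.
* `IsDiscreteValuationRing.motzkinSet_eq` — the stages: `P₀^{(k)} = {x ≠ 0 : v(x) ≥ k}` (Samuel's `A_k` = `{0} ∪
  {v ≤ k − 1}`), hence Motzkin's criterion (`forall_exists_not_mem_motzkinSet`), **Example (3) for `n = 1`**: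
  `θ(x) = motzkinRank x = 1 + v(x)` (`motzkinRank_eq`) and `motzkinNorm x = v(x)` (`motzkinNorm_eq`), and the
  minimality `v(x) ≤ φ(x)` for every `ℕ`-valued algorithm (`addVal_le_of_euclideanFunction`).
* `length_le_motzkinNorm_prod` — (2.1) in Motzkin's language for a general domain satisfying the criterion:
  `θ(p₁ ⋯ p_m) ≥ 1 + m` for non-zero non-units `pᵢ` (from Lenstra's superadditivity,
  `motzkinNorm_add_le_motzkinNorm_mul`), so every `ℕ`-valued algorithm takes value `≥ m` resp. `≥ 1 + m` in
  Samuel's normalisation (`length_le_of_euclideanFunction`).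
The general Proposition 5 (finitely many maximal ideals, Chinese remainder theorem) is not formalised here.

## Mathlib / tree search

Mathlib: `IsDiscreteValuationRing` with `addVal : AddValuation R ℕ∞` (`addVal_le_iff_dvd`, `addVal_eq_top_iff`,
`addVal_mul`, `addVal_uniformizer`, `exists_irreducible`), `AddValuation.map_add_eq_of_lt_left`, `ENat.coe_toNat`;
a DVR is a PID in Mathlib but no Euclidean structure / minimality statement is provided.  Tree: `MotzkinConstruction`
(`motzkinRank_le_iff`, `motzkinNorm_le`, `exists_euclideanFunction_iff_forall_exists_not_mem_motzkinSet`),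
`MinimalEuclideanFunctionSuperadditive` (`motzkinNorm_add_le_motzkinNorm_mul`).
-/

namespace Literature.Algebra.EuclideanDomain

open IsDiscreteValuationRing

/-! ## §1 Corollary to Proposition 5: a DVR is Euclidean for `1 + v` -/

section DVR

variable {R : Type*} [CommRing R] [IsDomain R] [IsDiscreteValuationRing R]

/-- In a DVR, `v(x) < v(y)` for `x ≠ 0` means `¬ y ∣ x`… precisely: `¬ b ∣ a ⇒ v(a) < v(b)`.
[cite: Samuel1971, Prop. 5 Cor. (p. 285)] -/
theorem IsDiscreteValuationRing.addVal_lt_of_not_dvd {a b : R} (h : ¬ b ∣ a) : addVal R a < addVal R b := by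
  rw [← not_le]; exact fun h' ↦ h (addVal_le_iff_dvd.mp h')

/-- `v` as an `ℕ`-valued function (`toNat`, `0 ↦ 0`) is strictly monotone on non-zero elements.
[cite: Samuel1971, Prop. 5 Cor. (p. 285)] -/
theorem IsDiscreteValuationRing.toNat_addVal_lt_iff {a b : R} (ha : a ≠ 0) (hb : b ≠ 0) :
    (addVal R a).toNat < (addVal R b).toNat ↔ addVal R a < addVal R b := by
  have ha' : addVal R a ≠ ⊤ := mt addVal_eq_top_iff.mp ha
  have hb' : addVal R b ≠ ⊤ := mt addVal_eq_top_iff.mp hb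
  rw [← ENat.coe_lt_coe, ENat.coe_toNat ha', ENat.coe_toNat hb']

/-- **Corollary to Proposition 5**: «The ring of a discrete valuation `v` is Euclidean for `φ(x) = 1 + v(x)`» — in
Motzkin's form (iii) with the `ℕ`-valued `v`: for `b ≠ 0`, `a = bq + s` with `s = 0` (if `b ∣ a`) or `v(s) < v(b)`
(`s = a` otherwise). [cite: Samuel1971, Prop. 5 Cor. (p. 285)] -/
theorem IsDiscreteValuationRing.euclidean_addVal :
    ∀ a b : R, b ≠ 0 → ∃ q s : R, a = b * q + s ∧ (s = 0 ∨ (addVal R s).toNat < (addVal R b).toNat) := by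
  intro a b hb
  by_cases hdvd : b ∣ a
  · obtain ⟨c, rfl⟩ := hdvd
    exact ⟨c, 0, by ring, Or.inl rfl⟩
  · have ha : a ≠ 0 := fun h ↦ hdvd (h ▸ dvd_zero b)
    exact ⟨0, a, by ring, Or.inr ((toNat_addVal_lt_iff ha hb).mpr (addVal_lt_of_not_dvd hdvd))⟩

open Classical in
/-- Samuel's literal form: `φ(x) = 1 + v(x)` for `x ≠ 0`, `φ(0) = 0`, satisfies (E) of Definition 1:
`a = bq + r` with `φ(r) < φ(b)`. [cite: Samuel1971, Prop. 5 Cor. (p. 285)] -/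
theorem IsDiscreteValuationRing.euclidean_one_add_addVal :
    ∀ a b : R, b ≠ 0 → ∃ q r : R, a = b * q + r ∧
      (if r = 0 then 0 else (addVal R r).toNat + 1) < (if b = 0 then 0 else (addVal R b).toNat + 1) := by
  intro a b hb
  obtain ⟨q, s, h, hs⟩ := euclidean_addVal a b hb
  refine ⟨q, s, h, ?_⟩
  rw [if_neg hb]
  rcases hs with hs | hs
  · rw [if_pos hs]; omega
  · by_cases hs0 : s = 0
    · rw [if_pos hs0]; omega
    · rw [if_neg hs0]; omega

/-! ## §2 Example (3), `n = 1`: the stages and the smallest algorithm of a DVR -/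

/-- The stages of the transfinite construction of a DVR: `P₀^{(k)} = {x ≠ 0 : v(x) ≥ k}` (Samuel's
`A_k = {0} ∪ {x : v(x) ≤ k − 1}`): if `v(b) ≥ k + 1` the class of `ϖ^k` stays inside `{v ≥ k}` (ultrametric
equality); if `v(b) = k`, every class `a + bA` contains `0` (when `b ∣ a`) or `a` itself with `v(a) < k`.
[cite: Samuel1971, §4 Example (3) (p. 290)] -/
theorem IsDiscreteValuationRing.motzkinSet_eq (k : ℕ) :
    (motzkinSet k : Set R) = {x | x ≠ 0 ∧ (k : ℕ∞) ≤ addVal R x} := by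
  induction k with
  | zero => ext x; simp [motzkinSet_zero]
  | succ k ih =>
    ext b
    rw [motzkinSet_succ, mem_motzkinDerived, ih]
    simp only [Set.mem_setOf_eq]
    constructor
    · rintro ⟨⟨hb0, hbk⟩, a, ha⟩
      refine ⟨hb0, ?_⟩
      by_contra hlt
      rw [not_le] at hlt
      -- `v(b) = k`
      by_cases hdvd : b ∣ a
      · obtain ⟨c, rfl⟩ := hdvd
        have := (ha (-c)).1
        exact this (by ring)
      · have hva : addVal R a < addVal R b := addVal_lt_of_not_dvd hdvd
        have := (ha 0).2
        rw [mul_zero, add_zero] at this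
        -- `k ≤ v a < v b < k + 1` is impossible in `ℕ∞`
        have hb' : addVal R b ≠ ⊤ := mt addVal_eq_top_iff.mp hb0
        obtain ⟨m, hm⟩ := ENat.ne_top_iff_exists.mp hb'
        rw [← hm] at hlt hva hbk
        have ha' : addVal R a ≠ ⊤ := by rintro h; rw [h] at hva; exact not_top_lt hva
        obtain ⟨n, hn⟩ := ENat.ne_top_iff_exists.mp ha'
        rw [← hn] at hva this
        norm_cast at hlt hva hbk this
        omega
    · rintro ⟨hb0, hbk⟩
      have hbk' : (k : ℕ∞) ≤ addVal R b := le_trans (by exact_mod_cast Nat.le_succ k) hbk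
      refine ⟨⟨hb0, hbk'⟩, ?_⟩
      obtain ⟨ϖ, hϖ⟩ := exists_irreducible R
      have hϖk : addVal R (ϖ ^ k) = k := by rw [addVal_pow, addVal_uniformizer hϖ]; simp
      refine ⟨ϖ ^ k, fun q ↦ ?_⟩
      -- `v(bq) ≥ k + 1 > k = v(ϖ^k)`, so `v(ϖ^k + bq) = k`
      have hlt : addVal R (ϖ ^ k) < addVal R (b * q) := by
        rw [hϖk, addVal_mul]
        calc (k : ℕ∞) < k + 1 := by exact_mod_cast Nat.lt_succ_self k
          _ ≤ addVal R b := by exact_mod_cast hbk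
          _ ≤ addVal R b + addVal R q := le_self_add
      have hsum : addVal R (ϖ ^ k + b * q) = k := by
        rw [AddValuation.map_add_eq_of_lt_left _ hlt, hϖk]
      refine ⟨fun h0 ↦ ?_, by rw [hsum]⟩
      rw [h0] at hsum
      simp at hsum

/-- Motzkin's criterion holds in a DVR: `x ∉ P₀^{(v(x)+1)}` (and `0 ∉ P₀`). [cite: Samuel1971, §4 Example (3) (p. 290)] -/
theorem IsDiscreteValuationRing.forall_exists_not_mem_motzkinSet :
    ∀ x : R, ∃ k : ℕ, x ∉ (motzkinSet k : Set R) := by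
  intro x
  by_cases hx : x = 0
  · exact ⟨0, by simp [motzkinSet_zero, hx]⟩
  · refine ⟨(addVal R x).toNat + 1, ?_⟩
    rw [IsDiscreteValuationRing.motzkinSet_eq]
    simp only [Set.mem_setOf_eq, not_and, not_le]
    intro _
    have hx' : addVal R x ≠ ⊤ := mt addVal_eq_top_iff.mp hx
    conv_lhs => rw [← ENat.coe_toNat hx']
    exact_mod_cast Nat.lt_succ_self _

/-- **Example (3), one maximal ideal**: «the smallest algorithm `θ` on `A` is given by `θ(x) = 1 + Σᵢ vᵢ(x)`» — for a
DVR, `θ(x) = motzkinRank x = 1 + v(x)` for `x ≠ 0`. [cite: Samuel1971, §4 Example (3) (p. 290)] -/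
theorem IsDiscreteValuationRing.motzkinRank_eq {x : R} (hx : x ≠ 0) :
    motzkinRank IsDiscreteValuationRing.forall_exists_not_mem_motzkinSet x = (addVal R x).toNat + 1 := by
  have hx' : addVal R x ≠ ⊤ := mt addVal_eq_top_iff.mp hx
  apply le_antisymm
  · rw [motzkinRank_le_iff, IsDiscreteValuationRing.motzkinSet_eq]
    simp only [Set.mem_setOf_eq, not_and, not_le]
    intro _
    conv_lhs => rw [← ENat.coe_toNat hx']
    exact_mod_cast Nat.lt_succ_self _
  · by_contra hlt
    have h := not_mem_motzkinSet_motzkinRank IsDiscreteValuationRing.forall_exists_not_mem_motzkinSet x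
    rw [IsDiscreteValuationRing.motzkinSet_eq] at h
    refine h ⟨hx, ?_⟩
    conv_rhs => rw [← ENat.coe_toNat hx']
    exact_mod_cast (by omega : motzkinRank IsDiscreteValuationRing.forall_exists_not_mem_motzkinSet x ≤
      (addVal R x).toNat)

/-- Motzkin's minimal Euclidean function of a DVR is the valuation: `|x|_M = v(x)` (`x ≠ 0`; both sides are `0`
at `0`). [cite: Samuel1971, §4 Example (3) (p. 290)] -/
theorem IsDiscreteValuationRing.motzkinNorm_eq (x : R) :
    motzkinNorm IsDiscreteValuationRing.forall_exists_not_mem_motzkinSet x = (addVal R x).toNat := by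
  unfold motzkinNorm
  by_cases hx : x = 0
  · subst hx
    rw [(motzkinRank_eq_zero_iff _).mpr rfl, addVal_zero]; rfl
  · rw [IsDiscreteValuationRing.motzkinRank_eq hx]; rfl

/-- The valuation is the SMALLEST `ℕ`-valued algorithm on a DVR: `v(x) ≤ φ(x)` for every Euclidean function `φ`
(form (iii)) and `x ≠ 0`. [cite: Samuel1971, §4 Example (3) (p. 290)] -/
theorem IsDiscreteValuationRing.addVal_le_of_euclideanFunction {φ : R → ℕ}
    (hφ : ∀ a b : R, b ≠ 0 → ∃ q s : R, a = b * q + s ∧ (s = 0 ∨ φ s < φ b)) {x : R} (hx : x ≠ 0) :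
    (addVal R x).toNat ≤ φ x := by
  rw [← IsDiscreteValuationRing.motzkinNorm_eq x]
  exact motzkinNorm_le _ hφ hx

end DVR

/-! ## §3 Corollary 2 to Proposition 4: `θ(x) ≥ 1 + Σ v_p(x)` -/

section Cor2

variable {R : Type*} [CommRing R] [IsDomain R] (h : ∀ b : R, ∃ k : ℕ, b ∉ (motzkinSet k : Set R))

omit [IsDomain R] in
/-- A non-zero non-unit has Motzkin norm `≥ 1` (it lies in `P₀′`). [cite: Samuel1971, §4 (4.5) (p. 289)] -/
theorem one_le_motzkinNorm_of_not_isUnit {x : R} (hx : x ≠ 0) (hu : ¬IsUnit x) : 1 ≤ motzkinNorm h x := by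
  have hx1 : x ∈ (motzkinSet 1 : Set R) := by rw [motzkinSet_one]; exact ⟨hx, hu⟩
  have : ¬motzkinRank h x ≤ 1 := fun hle ↦ (motzkinRank_le_iff h).mp hle hx1
  unfold motzkinNorm
  omega

/-- **Corollary 2 to Proposition 4, (2.1)** in Motzkin's language: a product of `m` non-zero non-units (e.g. primes,
counted with multiplicity) has Motzkin norm `≥ m`, i.e. `θ = motzkinRank ≥ 1 + m` — by induction on `m` from the
superadditivity `|xy|_M ≥ |x|_M + |y|_M`. [cite: Samuel1971, §2 Cor. 2 to Prop. 4 (pp. 284–285)] -/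
theorem length_le_motzkinNorm_prod (l : List R) (hl : ∀ p ∈ l, p ≠ 0 ∧ ¬IsUnit p) :
    l.length ≤ motzkinNorm h l.prod := by
  induction l with
  | nil => simp
  | cons p l ih =>
    have hp := hl p (by simp)
    have hl' : ∀ q ∈ l, q ≠ 0 ∧ ¬IsUnit q := fun q hq ↦ hl q (by simp [hq])
    have hprod : l.prod ≠ 0 := List.prod_ne_zero fun h0 ↦ (hl' 0 h0).1 rfl
    rw [List.prod_cons, List.length_cons]
    have h1 := one_le_motzkinNorm_of_not_isUnit h hp.1 hp.2
    have h2 := motzkinNorm_add_le_motzkinNorm_mul h hp.1 hprod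
    have h3 := ih hl'
    omega

/-- (2.1) for an arbitrary `ℕ`-valued algorithm `φ` (form (iii)): `φ(p₁ ⋯ p_m) ≥ m` for non-zero non-units `pᵢ`
(Samuel's `φ ≥ 1 + Σ v_p` in his normalisation `φ(unit) ≥ 1`). [cite: Samuel1971, §2 Cor. 2 to Prop. 4 (pp. 284–285)] -/
theorem length_le_of_euclideanFunction {φ : R → ℕ}
    (hφ : ∀ a b : R, b ≠ 0 → ∃ q s : R, a = b * q + s ∧ (s = 0 ∨ φ s < φ b)) (l : List R)
    (hl : ∀ p ∈ l, p ≠ 0 ∧ ¬IsUnit p) : l.length ≤ φ l.prod := by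
  have h : ∀ b : R, ∃ k : ℕ, b ∉ (motzkinSet k : Set R) := exists_not_mem_motzkinSet_of_euclideanFunction hφ
  have hprod : l.prod ≠ 0 := List.prod_ne_zero fun h0 ↦ (hl 0 h0).1 rfl
  exact (length_le_motzkinNorm_prod h l hl).trans (motzkinNorm_le h hφ hprod)

end Cor2

end Literature.Algebra.EuclideanDomain
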